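import Literature.Analysis.UnboundedOperators.SemilinearMildTube
import Summits.AnomalousDissipation.AnomalousDissipation.Theorems.BaireTransferDenseLoudDesignerForcesErgodicLine

/-!
# Mild solutions in a tube around a reference trajectory (tools stub `stub_mildTubeTools`, block N-R,
# line `ergodic-budget-selection-closing`, crux `BaireTransfer.DenseLoudDesignerForces`, stmt-AnomalousDissipation-1143)

Summit-side copy of the Literature theorem `Literature.Analysis.UnboundedOperators.exists_mildTube`
(`Literature/Analysis/UnboundedOperators/SemilinearMildTube.lean`, any real Banach space `E`): in the setting
of the smooth local mild flow S4 (`T` a strongly continuous contraction semigroup, `K` weakly singular,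
`‖K t‖ ≤ C t^{-α}` with `α < 1`, strongly continuous on `(0, ∞)` and intertwined `K (s + t) = T s ∘ K t`, `N`
bounded bilinear, constant forcing `f`), let `yc ∈ C([0, L]; E)` be a mild solution on `[0, L]` (a reference
trajectory).  For every `ε > 0` there are `δ > 0`, a constant `Lip` and a solution map `Ψ : E → C([0, L]; E)`
with

* `Ψ` continuous on the ball `‖y₀ − yc 0‖ < δ` (into the Banach space `C([0, L]; E)`);
* `y₀ ↦ Ψ y₀ t` of class `C^∞` on the ball, for every `t ∈ [0, L]`;
* for `‖y₀ − yc 0‖ < δ`: `Ψ y₀` the mild solution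
  `y(t) = T(t) y₀ + ∫₀ᵗ T(t − s) f ds − ∫₀ᵗ K(t − s) N(y(s), y(s)) ds` on `[0, L]`, in the `ε`-tube around `yc`
  with `‖Ψ y₀ t − yc t‖ ≤ Lip ‖y₀ − yc 0‖`;
* the derivative `w(t) = D(Ψ · t)(y₀) h` continuous in `t` and solving the linearised mild equation
  `w(t) = T(t) h − ∫₀ᵗ K(t − s) (N(y(s), w(s)) + N(w(s), y(s))) ds` along `y = Ψ y₀`.

Architecture of the proof (all in `Literature/Analysis/UnboundedOperators/`): shift / concatenation of
Duhamel identities (`SemilinearMildTubeShift.lean`), Lipschitz stability of bounded mild solutions by the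
singular Grönwall inequality (`SemilinearMildTubeLipschitz.lean`, on `ODE/SingularGronwall.lean`, tools
stub SG), the local smooth flow with its a-priori bound on every short window
(`SemilinearMildTubeLocal.lean`, on the S4 chain `SemilinearMildFlow*.lean`), the continuation step
(`SemilinearMildTubeStep.lean`: junction values stay in the ball, chain rule through the evaluation
functional, concatenation of the mild and linearised identities) and the iteration over `n` windows of
length `L / n` plus the packaging into `C([0, L]; E)` (`SemilinearMildTube.lean`).  Block N-R applies this
with `E = Hsp`, `T = e^{-νtA}`, `K = A^{3/4} e^{-νtA}` and the reference trajectory of a core state to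
realise the Navier–Stokes semiflow near the invariant core as a smooth model.  The registered signature
also carries `0 ≤ α`; the conclusions do not need it.

References: D. Henry, *Geometric Theory of Semilinear Parabolic Equations*, LNM 840 (1981), Thm 3.3.4,
Thm 3.4.1, Thm 3.4.4, Cor. 3.4.6, Lemma 7.1.1; A. Pazy, *Semigroups of Linear Operators and Applications to
PDE* (1983), Thm 6.3.1.  Nothing is asserted; no definition is added.
-/

-- `Summit.<Summit>.<Problem>` is the tree's mandated summit-side namespace (CONVENTIONS §2); for this
-- single-conjunct summit the two coincide, so the duplicate is deliberate.
set_option linter.dupNamespace false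

noncomputable section

open scoped BigOperators Topology ENNReal InnerProductSpace ContDiff
open Filter Set Function MeasureTheory

namespace Summit.AnomalousDissipation.AnomalousDissipation.Theorems.DenseLoudDesignerForces.Ergodic

open Literature.Analysis.FunctionSpaces Literature.Analysis.FunctionSpaces.Torus
open Literature.Analysis.FluidPDE Literature.Analysis.FluidPDE.Torus

/-- **Tools stub S4c of block N-R (`stub_mildTubeTools`) — mild solutions in a tube: continuation,
Lipschitz stability and smooth dependence up to a prescribed time.**  In the setting of S4 (`T`
contraction semigroup, `K` weakly singular smoothing family with `K (s + t) = T s ∘ K t`, `N` bounded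
bilinear, constant forcing `f`), let `yc ∈ C([0, L]; E)` be a mild solution on `[0, L]`.  Then for every
`ε > 0` there are `δ > 0`, a constant `Lip` and a solution map `Ψ : E → C([0, L]; E)` such that for every
datum `y₀` with `‖y₀ − yc 0‖ < δ`: `Ψ y₀` is a mild solution on `[0, L]` from `y₀` staying in the `ε`-tube
around `yc` with `‖Ψ y₀ t − yc t‖ ≤ Lip ‖y₀ − yc 0‖`; `Ψ` is continuous into `C([0, L]; E)`; for each time
`t` the map `y₀ ↦ Ψ y₀ t` is `C^∞` on the ball; and its derivative `w(t) = D(Ψ · t)(y₀) h` is continuous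
in `t` and solves the mild linearised equation along `Ψ y₀` —
`Literature.Analysis.UnboundedOperators.exists_mildTube` (Henry 1981, Thm 3.3.4, Thm 3.4.1, Cor. 3.4.6).
[cite: Henry1981, Thm 3.3.4, Thm 3.4.1 and Cor 3.4.6] -/
theorem stub_mildTubeTools {E : Type*} [NormedAddCommGroup E] [NormedSpace ℝ E] [CompleteSpace E]
    (T K : ℝ → E →L[ℝ] E) (hT0 : T 0 = 1) (hTadd : ∀ s t, 0 ≤ s → 0 ≤ t → T (s + t) = (T s).comp (T t))
    (hTnorm : ∀ t, 0 ≤ t → ‖T t‖ ≤ 1) (hTc : ∀ y : E, Continuous fun t : ℝ => T t y)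
    {α C : ℝ} (hα₀ : 0 ≤ α) (hα : α < 1) (hC : 0 ≤ C) (hK : ∀ t, 0 < t → ‖K t‖ ≤ C * t ^ (-α))
    (hKadd : ∀ s t, 0 ≤ s → 0 < t → K (s + t) = (T s).comp (K t)) (hKc : ∀ y : E, ContinuousOn (fun t : ℝ => K t y) (Ioi 0))
    (N : E →L[ℝ] E →L[ℝ] E) (f : E) {L : ℝ} (hL : 0 < L) (yc : C(Icc (0 : ℝ) L, E))
    (hyc : ∀ t : Icc (0 : ℝ) L, yc t = T t (yc ⟨0, le_rfl, hL.le⟩) + (∫ s in (0 : ℝ)..(t : ℝ), T ((t : ℝ) - s) f) -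
      ∫ s in (0 : ℝ)..(t : ℝ), K ((t : ℝ) - s) (N (yc (Set.projIcc 0 L hL.le s)) (yc (Set.projIcc 0 L hL.le s))))
    {ε : ℝ} (hε : 0 < ε) :
    ∃ δ : ℝ, 0 < δ ∧ ∃ Lip : ℝ, ∃ Ψ : E → C(Icc (0 : ℝ) L, E),
      ContinuousOn Ψ (Metric.ball (yc ⟨0, le_rfl, hL.le⟩) δ) ∧
      (∀ t : Icc (0 : ℝ) L, ContDiffOn ℝ ∞ (fun y₀ => Ψ y₀ t) (Metric.ball (yc ⟨0, le_rfl, hL.le⟩) δ)) ∧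
      ∀ y₀ ∈ Metric.ball (yc ⟨0, le_rfl, hL.le⟩) δ,
        (∀ t : Icc (0 : ℝ) L, Ψ y₀ t = T t y₀ + (∫ s in (0 : ℝ)..(t : ℝ), T ((t : ℝ) - s) f) -
          ∫ s in (0 : ℝ)..(t : ℝ), K ((t : ℝ) - s) (N (Ψ y₀ (Set.projIcc 0 L hL.le s)) (Ψ y₀ (Set.projIcc 0 L hL.le s)))) ∧
        (∀ t : Icc (0 : ℝ) L, ‖Ψ y₀ t - yc t‖ ≤ Lip * ‖y₀ - yc ⟨0, le_rfl, hL.le⟩‖ ∧ ‖Ψ y₀ t - yc t‖ < ε) ∧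
        ∀ h : E, Continuous (fun t : Icc (0 : ℝ) L => fderiv ℝ (fun y => Ψ y t) y₀ h) ∧
          ∀ t : Icc (0 : ℝ) L, fderiv ℝ (fun y => Ψ y t) y₀ h = T t h - ∫ s in (0 : ℝ)..(t : ℝ), K ((t : ℝ) - s)
            (N (Ψ y₀ (Set.projIcc 0 L hL.le s)) (fderiv ℝ (fun y => Ψ y (Set.projIcc 0 L hL.le s)) y₀ h) +
              N (fderiv ℝ (fun y => Ψ y (Set.projIcc 0 L hL.le s)) y₀ h) (Ψ y₀ (Set.projIcc 0 L hL.le s))) := by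
  -- `hα₀` belongs to the registered signature; the Literature theorem does not need it.
  have _h : 0 ≤ α := hα₀
  exact Literature.Analysis.UnboundedOperators.exists_mildTube T K hT0 hTadd hTnorm hTc hα hC hK hKadd hKc
    N f hL yc hyc hε

end Summit.AnomalousDissipation.AnomalousDissipation.Theorems.DenseLoudDesignerForces.Ergodic

end
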